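import Summits.NavierStokesRegularity.NavierStokesRegularity.Theorems.ExtremiserTransienceNearExtremalTransienceExtremiserLiouvilleConstantSpeedBlowDownWeakLimit
import HarnessLib

/-!
# Crux `ExtremiserTransience.NearExtremalTransience` (stmt-NavierStokesRegularity-21883), line `extremiser_liouville`,
# stub K1b — WEAK BLOW-DOWN LIMITS VANISH AT EVERY AMPLITUDE NORMALISATION `R^a`, `a ≤ 1` (the flat / super-conical scales)

`--supports stmt-NavierStokesRegularity-21883` (helper).  Author: prover seat `ns-el-k1b` (g6).  `blowDown_weakLimit_ae_eq_zero`
is the case `a = 1` (the jet normalisation).  For the FLAT alternative or a super-conical jet the excess energy grows like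
`∫_{B_ρ}‖v − c‖² ≍ ρ^γ` with `1 ≤ γ ≤ 2` (`L⁶`), and the `L²_loc`-normalised blow-down is `R^a(v(R·) − c)` with `a = (3−γ)/2 ≤ 1`.
The same argument applies: the field is `R^{a−1}` times the `a = 1` blow-down, `R^{a−1} ≤ 1`, so it is weakly solenoidal and its
curl-type pairings are `R^{a−1}·(R⁻¹∫⟪ω, g(R⁻¹·)(c′×a)⟫) → 0` by g6's vorticity law; a pairings-limit with sub-cubic growth is
therefore `0` (div–curl growth Liouville).  So at EVERY first-order blow-down scale the residue leaves only concentration or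
evanescence, never a limit field.

* `blowDown_weakLimit_ae_eq_zero_of_exponent` : the statement above.

WHAT THIS IS NOT: K1b is NOT proved; nothing here proves NS regularity. [folklore]
-/

noncomputable section

open Set Filter Topology MeasureTheory Metric Function
open scoped ENNReal NNReal Topology InnerProductSpace RealInnerProductSpace ContDiff
open Literature.Analysis.FluidPDE Literature.Analysis

namespace Summit.NavierStokesRegularity.NavierStokesRegularity.Theorems

-- the problem directory repeats the summit name (`NavierStokesRegularity/NavierStokesRegularity`)
set_option linter.dupNamespace false

namespace ExtremiserLiouville

open DepletionLadder.KStar DepletionLadder.KStar.HalfSpace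

variable {v : E3 → E3} {c : E3}

/-- The `R^a`-normalised blow-down is `R^{a−1}` times the `R`-normalised one. [folklore] -/
theorem rpow_blowDown_eq (v : E3 → E3) (c : E3) {R : ℝ} (hR : 0 < R) (a : ℝ) (x : E3) :
    R ^ a • (v (R • x) - c) = R ^ (a - 1) • (R • (v (R • x) - c)) := by
  rw [smul_smul, ← Real.rpow_add_one hR.ne' (a - 1), sub_add_cancel]

/-- **Weak blow-down limits vanish at every normalisation `R^a`, `a ≤ 1`.**  Residue `(v, μ)` as in
`blowDown_weakLimit_ae_eq_zero`; `Rₙ ≥ 1`, `Rₙ → ∞`; if the pairings of `x ↦ Rₙ^a (v(Rₙx) − c)` with every continuous compactly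
supported field converge to those of a locally integrable `U` with `∫⁻_{B_L}‖U‖ₑ² ≤ C L^θ` (`L ≥ 1`, `θ < 3`), then `U = 0` a.e.
(K1b itself is NOT proved here.) [folklore] -/
theorem blowDown_weakLimit_ae_eq_zero_of_exponent (hv : ContDiff ℝ ∞ v) (hdiv : VectorCalculus.IsDivFree v) {M : ℝ}
    (hM : ∀ x, ‖v x‖ = M) (h1 : ∫⁻ x, ‖iteratedFDeriv ℝ 1 v x‖ₑ ^ 2 < ⊤) (h2 : ∫⁻ x, ‖iteratedFDeriv ℝ 2 v x‖ₑ ^ 2 < ⊤)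
    (hpos : 0 < M * Real.sqrt (Zen v) * Real.sqrt (Wpa v))
    (μ : Measure E3) [IsFiniteMeasure μ]
    (hμ : ∀ ψ : E3 → E3, ContDiff ℝ ∞ ψ → HasCompactSupport ψ → VectorCalculus.IsDivFree ψ →
      Jst v * J1 v ψ - kStar ^ 2 * M ^ 2 * (Wpa v * A1 v ψ + Zen v * C1 v ψ) = ∫ x, ⟪v x, ψ x⟫_ℝ ∂μ)
    (hc : c ≠ 0) (hcM : ‖c‖ = M) (hL6 : MemLp (fun x => v x - c) 6 volume)
    {a : ℝ} (ha : a ≤ 1) {Rn : ℕ → ℝ} (hRn1 : ∀ n, 1 ≤ Rn n) (hRn : Tendsto Rn atTop atTop)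
    {U : E3 → E3} (hU : AEStronglyMeasurable U volume) (hUl : LocallyIntegrable U volume)
    (hweak : ∀ Φ : E3 → E3, Continuous Φ → HasCompactSupport Φ →
      Tendsto (fun n => ∫ x, ⟪Rn n ^ a • (v (Rn n • x) - c), Φ x⟫_ℝ) atTop (𝓝 (∫ x, ⟪U x, Φ x⟫_ℝ)))
    {C θ : ℝ} (hC : 0 ≤ C) (hθ0 : 0 ≤ θ) (hθ : θ < 3)
    (hA : ∀ L : ℝ, 1 ≤ L → ∫⁻ x in ball (0 : E3) L, ‖U x‖ₑ ^ 2 ≤ ENNReal.ofReal (C * L ^ θ)) :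
    U =ᵐ[volume] 0 := by
  have hRn0 : ∀ n, 0 < Rn n := fun n => one_pos.trans_le (hRn1 n)
  have hv1 : ContDiff ℝ 1 v := hv.of_le (by exact_mod_cast le_top)
  -- the `R^a` pairing is `R^{a-1}` times the `R` pairing
  have hscale : ∀ (n : ℕ) (Φ : E3 → E3), ∫ x, ⟪Rn n ^ a • (v (Rn n • x) - c), Φ x⟫_ℝ =
      Rn n ^ (a - 1) * ∫ x, ⟪Rn n • (v (Rn n • x) - c), Φ x⟫_ℝ := by
    intro n Φ
    rw [← integral_const_mul]
    refine integral_congr_ae (Eventually.of_forall fun x => ?_)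
    show ⟪Rn n ^ a • (v (Rn n • x) - c), Φ x⟫_ℝ = Rn n ^ (a - 1) * ⟪Rn n • (v (Rn n • x) - c), Φ x⟫_ℝ
    rw [rpow_blowDown_eq v c (hRn0 n) a x, real_inner_smul_left]
  have hfac1 : ∀ n, |Rn n ^ (a - 1)| ≤ 1 := fun n => by
    rw [abs_of_nonneg (Real.rpow_nonneg (hRn0 n).le _)]
    exact Real.rpow_le_one_of_one_le_of_nonpos (hRn1 n) (by linarith)
  have huniq : ∀ Φ : E3 → E3, Continuous Φ → HasCompactSupport Φ →
      Tendsto (fun n => ∫ x, ⟪Rn n • (v (Rn n • x) - c), Φ x⟫_ℝ) atTop (𝓝 0) → ∫ x, ⟪U x, Φ x⟫_ℝ = 0 := by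
    intro Φ hΦ hΦc h0
    have h0' : Tendsto (fun n => ∫ x, ⟪Rn n ^ a • (v (Rn n • x) - c), Φ x⟫_ℝ) atTop (𝓝 0) := by
      simp_rw [hscale]
      refine squeeze_zero_norm (fun n => ?_) (tendsto_norm_zero.comp h0)
      rw [Real.norm_eq_abs, abs_mul]
      exact (mul_le_mul_of_nonneg_right (hfac1 n) (abs_nonneg _)).trans_eq (one_mul _)
    exact tendsto_nhds_unique (hweak Φ hΦ hΦc) h0'
  -- weakly solenoidal
  have hdivU : IsWeaklyDivFree U := by
    intro θ' hθ'
    have hθ1 : ContDiff ℝ 1 θ' := hθ'.contDiff.of_le (by exact_mod_cast le_top)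
    have hgc : Continuous (gradient θ') := by
      unfold gradient
      exact (InnerProductSpace.toDual ℝ E3).symm.continuous.comp (hθ1.continuous_fderiv one_ne_zero)
    have hgs : HasCompactSupport (gradient θ') :=
      (hθ'.hasCompactSupport.fderiv (𝕜 := ℝ)).comp_left (g := (InnerProductSpace.toDual ℝ E3).symm) (map_zero _)
    refine huniq _ hgc hgs (tendsto_const_nhds.congr' (Eventually.of_forall fun n => ?_))
    exact (VectorCalculus.IsDivFree.isWeaklyDivFree_holds (isDivFree_blowDown (hv1.differentiable one_ne_zero) hdiv c (Rn n))
      (contDiff_blowDown hv1 c (Rn n)) θ' hθ').symm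
  -- annihilates curl-type test fields (g6's vorticity law)
  have hcurlU : ∀ g : E3 → ℝ, FunctionSpaces.IsTestFunctionOn (⊤ : TopologicalSpace.Opens E3) g → ∀ a' c' : E3,
      ∫ x, ⟪U x, fderiv ℝ g x a' • c' - fderiv ℝ g x c' • a'⟫_ℝ = 0 := by
    intro g hg a' c'
    have hg1 : ContDiff ℝ 1 g := hg.contDiff.of_le (by exact_mod_cast le_top)
    have hDg : Continuous (fderiv ℝ g) := hg1.continuous_fderiv one_ne_zero
    have hΦc : Continuous fun x => fderiv ℝ g x a' • c' - fderiv ℝ g x c' • a' :=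
      ((hDg.clm_apply continuous_const).smul continuous_const).sub ((hDg.clm_apply continuous_const).smul continuous_const)
    have hΦs : HasCompactSupport fun x => fderiv ℝ g x a' • c' - fderiv ℝ g x c' • a' :=
      (hg.hasCompactSupport.fderiv (𝕜 := ℝ)).mono fun x hx => by
        rw [mem_support] at hx ⊢
        intro h0; exact hx (by rw [h0]; simp)
    have hB : ContDiff ℝ ∞ fun y => g y • cross c' a' := hg.contDiff.smul contDiff_const
    have hBc : HasCompactSupport fun y => g y • cross c' a' := hg.hasCompactSupport.smul_right
    have hT := (tendsto_blowDown_vorticity_zero_general hv hdiv hM h1 h2 hpos μ hμ hc hcM hL6 hB hBc).comp hRn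
    refine huniq _ hΦc hΦs (hT.congr fun n => ?_)
    show (Rn n)⁻¹ * ∫ y, ⟪curl v y, g ((Rn n)⁻¹ • y) • cross c' a'⟫_ℝ =
      ∫ x, ⟪Rn n • (v (Rn n • x) - c), fderiv ℝ g x a' • c' - fderiv ℝ g x c' • a'⟫_ℝ
    exact (integral_inner_curlPair_blowDown hv1 c hg1 hg.hasCompactSupport a' c' (hRn0 n)).symm
  exact ae_eq_zero_of_weaklyDivFree_of_curlFree_of_growth hU hUl hdivU hcurlU hC hθ0 hθ hA

end ExtremiserLiouville

end Summit.NavierStokesRegularity.NavierStokesRegularity.Theorems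

end
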